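import Summits.HodgeConjecture.CorCM.IrreducibleOddWeightsCommutantCentre
import Summits.HodgeConjecture.CorCM.IrreducibleOddWeightsCommutantBases
import HarnessLib

/-!
# Density over the commutant, XVI: COMMUTING OPERATORS — then `span(T) ≤ 𝒟`, the commutant IS the operator algebra
# on `A` (`𝒟|_A = span(T)|_A = Z|_A`), it is commutative, and `δ = dim A`

COR-CM (cell `pub-hodgecm2`, binder seat `b16` gen 74, count-neutral claim THE CENTRE, file Z3 — abstract linear
algebra over `ℚ`; theorems only, no definition, no named fact, no `sorry`).  NEW as stated, hence under `Summits/`.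
HONEST FRAMING: the abelian case of the double-centralizer formalism of gen 72/73 (files C1–C3, K1–K2) and file Z1:
if the operators `T_i` COMMUTE on the finite-dimensional stable irreducible `A` (e.g. `T_k` = translation by `k` in an
ABELIAN group `G` acting on `ℚ^Y`), the Wedderburn count `dim 𝒟|_A · dim span(T)|_A = (dim A)²` together with
`span(T)|_A ≤ 𝒟|_A` and `δ ∣ dim A` forces `δ = dim span(T)|_A = dim A`: the commutant is a (commutative) FIELD of
degree `dim A` and coincides on `A` with the image of the operator algebra — the rational form of «irreducible
representations of an abelian group have commutative endomorphism algebra `ℚ(χ)` of degree equal to their dimension»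
(gen 59 `…IndexBound` has `dim V = dim End_G V` in Mathlib's `Representation` currency; here in the lane's
unbundled currency, with the identification of the two algebras).  Nothing about Hodge classes is asserted; `HC_CM`
is neither used nor asserted.

* §1 `mem_commutant_of_comm` / `span_range_le_commutant_of_comm` (`span(T) ≤ 𝒟`),
  `map_domRestrict'_span_le_centre_of_comm` (`span(T)|_A ≤ Z|_A`), `map_domRestrict'_centre_eq_span_of_comm`
  (`Z|_A = span(T)|_A`).
* §2 **`finrank_map_applyₗ_eq_finrank_of_comm`: `δ = dim A`**; **`map_domRestrict'_commutant_eq_span_of_comm`: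
  `𝒟|_A = span(T)|_A`**; `finrank_map_domRestrict'_span_eq_finrank_of_comm` (`dim span(T)|_A = dim A`);
  **`commutant_apply_comm_of_comm`** (the commutant is COMMUTATIVE on `A`); `map_applyₗ_eq_of_comm` (`D·a₀ = A`:
  the commutant is transitive on `A ∖ 0`).

## References

* [CurtisReiner1962] C. W. Curtis, I. Reiner, *Representation Theory of Finite Groups and Associative Algebras*,
  §27 (27.3), §59.
* [Lang2002] S. Lang, *Algebra*, 3rd ed., XVII §1 Prop. 1.1, XVII §3 Cor. 3.5.
* [Serre1977] J.-P. Serre, *Linear Representations of Finite Groups*, GTM 42, §3.1 (abelian groups), §12.1.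
-/

set_option autoImplicit false

noncomputable section

open scoped BigOperators Classical

universe v w

namespace Summit.HodgeConjecture.CorCM.IrrOdd

variable {V : Type v} [AddCommGroup V] [Module ℚ V] {ι : Type w} (T : ι → V →ₗ[ℚ] V)

/-! ### §1 Commuting operators lie in their own commutant -/

/-- **COMMUTING OPERATORS LIE IN THE COMMUTANT**: if the `T_i` commute on `A` then every `T_i ∈ 𝒟`.
[cite: Serre1977, §3.1] [cite: CurtisReiner1962, §27 (27.3)] -/
theorem mem_commutant_of_comm {𝒟 : Submodule ℚ (V →ₗ[ℚ] V)} {A : Submodule ℚ V}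
    (h𝒟 : ∀ L : V →ₗ[ℚ] V, L ∈ 𝒟 ↔ (∀ a ∈ A, L a ∈ A) ∧ ∀ (i : ι) (a : V), a ∈ A → L (T i a) = T i (L a))
    (hAst : ∀ (i : ι) (v : V), v ∈ A → T i v ∈ A)
    (hTc : ∀ (i j : ι) (a : V), a ∈ A → T i (T j a) = T j (T i a)) (i : ι) : T i ∈ 𝒟 :=
  (h𝒟 (T i)).2 ⟨fun a ha => hAst i a ha, fun j a ha => hTc i j a ha⟩

/-- **`span(T) ≤ 𝒟`** for commuting operators. [cite: Serre1977, §3.1] -/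
theorem span_range_le_commutant_of_comm {𝒟 : Submodule ℚ (V →ₗ[ℚ] V)} {A : Submodule ℚ V}
    (h𝒟 : ∀ L : V →ₗ[ℚ] V, L ∈ 𝒟 ↔ (∀ a ∈ A, L a ∈ A) ∧ ∀ (i : ι) (a : V), a ∈ A → L (T i a) = T i (L a))
    (hAst : ∀ (i : ι) (v : V), v ∈ A → T i v ∈ A)
    (hTc : ∀ (i j : ι) (a : V), a ∈ A → T i (T j a) = T j (T i a)) :
    Submodule.span ℚ (Set.range T) ≤ 𝒟 := by
  rw [Submodule.span_le]
  rintro _ ⟨i, rfl⟩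
  exact mem_commutant_of_comm T h𝒟 hAst hTc i

/-- **`span(T)|_A ≤ Z|_A`**: commuting operators are CENTRAL (`span(T) ≤ 𝒟` and `span(T) ≤ ℬ`, gen 73 K2).
[cite: CurtisReiner1962, §59] [cite: Serre1977, §3.1] -/
theorem map_domRestrict'_span_le_centre_of_comm {𝒟 ℬ : Submodule ℚ (V →ₗ[ℚ] V)} {A : Submodule ℚ V}
    (h𝒟 : ∀ L : V →ₗ[ℚ] V, L ∈ 𝒟 ↔ (∀ a ∈ A, L a ∈ A) ∧ ∀ (i : ι) (a : V), a ∈ A → L (T i a) = T i (L a))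
    (hℬ : ∀ ψ : V →ₗ[ℚ] V, ψ ∈ ℬ ↔ (∀ a ∈ A, ψ a ∈ A) ∧
      ∀ (L : ↥𝒟) (a : V), a ∈ A → ψ ((L : V →ₗ[ℚ] V) a) = (L : V →ₗ[ℚ] V) (ψ a))
    (hAst : ∀ (i : ι) (v : V), v ∈ A → T i v ∈ A)
    (hTc : ∀ (i j : ι) (a : V), a ∈ A → T i (T j a) = T j (T i a)) :
    (Submodule.span ℚ (Set.range T)).map (LinearMap.domRestrict' A) ≤ (𝒟 ⊓ ℬ).map (LinearMap.domRestrict' A) :=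
  Submodule.map_mono (le_inf (span_range_le_commutant_of_comm T h𝒟 hAst hTc)
    (span_range_le_bicommutant T h𝒟 hℬ hAst))

/-- **`Z|_A = span(T)|_A`** for commuting operators (`A` finite-dimensional stable irreducible, `T` closed under
composition with identity): file Z1's `Z|_A = 𝒟|_A ⊓ span(T)|_A` with `span(T)|_A ≤ 𝒟|_A`.
[cite: CurtisReiner1962, §59] [cite: Serre1977, §3.1] -/
theorem map_domRestrict'_centre_eq_span_of_comm {𝒟 ℬ : Submodule ℚ (V →ₗ[ℚ] V)} {A : Submodule ℚ V}
    [FiniteDimensional ℚ A]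
    (h𝒟 : ∀ L : V →ₗ[ℚ] V, L ∈ 𝒟 ↔ (∀ a ∈ A, L a ∈ A) ∧ ∀ (i : ι) (a : V), a ∈ A → L (T i a) = T i (L a))
    (hℬ : ∀ ψ : V →ₗ[ℚ] V, ψ ∈ ℬ ↔ (∀ a ∈ A, ψ a ∈ A) ∧
      ∀ (L : ↥𝒟) (a : V), a ∈ A → ψ ((L : V →ₗ[ℚ] V) a) = (L : V →ₗ[ℚ] V) (ψ a))
    (h1 : ∃ i₀ : ι, T i₀ = LinearMap.id) (hmul : ∀ i i' : ι, ∃ i'' : ι, T i'' = T i ∘ₗ T i')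
    (hAst : ∀ (i : ι) (v : V), v ∈ A → T i v ∈ A)
    (hAirr : ∀ W : Submodule ℚ V, W ≤ A → W ≠ ⊥ → (∀ (i : ι) (v : V), v ∈ W → T i v ∈ W) → W = A)
    (hTc : ∀ (i j : ι) (a : V), a ∈ A → T i (T j a) = T j (T i a)) :
    (𝒟 ⊓ ℬ).map (LinearMap.domRestrict' A) = (Submodule.span ℚ (Set.range T)).map (LinearMap.domRestrict' A) := by
  rw [map_domRestrict'_centre_eq_inf_span T h𝒟 hℬ h1 hmul hAst hAirr]
  exact inf_eq_right.2 (Submodule.map_mono (span_range_le_commutant_of_comm T h𝒟 hAst hTc))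

/-! ### §2 `δ = dim A`; the commutant is the operator algebra and is commutative -/

/-- **`δ = dim A` FOR COMMUTING OPERATORS** (`0 ≠ a₀ ∈ A`): `dim 𝒟|_A · dim span(T)|_A = (dim A)²` (gen 73 K1),
`span(T)|_A ≤ 𝒟|_A` and `δ ∣ dim A` (gen 72 C1) leave only `δ = dim span(T)|_A = dim A` — the commutant of an
irreducible rational representation of an ABELIAN family is a field of degree equal to the dimension.
[cite: Serre1977, §3.1 and §12.1] [cite: Lang2002, XVII §3 Cor. 3.5] -/
theorem finrank_map_applyₗ_eq_finrank_of_comm {𝒟 : Submodule ℚ (V →ₗ[ℚ] V)} {A : Submodule ℚ V}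
    [FiniteDimensional ℚ A]
    (h𝒟 : ∀ L : V →ₗ[ℚ] V, L ∈ 𝒟 ↔ (∀ a ∈ A, L a ∈ A) ∧ ∀ (i : ι) (a : V), a ∈ A → L (T i a) = T i (L a))
    (h1 : ∃ i₀ : ι, T i₀ = LinearMap.id) (hmul : ∀ i i' : ι, ∃ i'' : ι, T i'' = T i ∘ₗ T i')
    (hAst : ∀ (i : ι) (v : V), v ∈ A → T i v ∈ A)
    (hAirr : ∀ W : Submodule ℚ V, W ≤ A → W ≠ ⊥ → (∀ (i : ι) (v : V), v ∈ W → T i v ∈ W) → W = A)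
    (hTc : ∀ (i j : ι) (a : V), a ∈ A → T i (T j a) = T j (T i a)) {a₀ : V} (ha₀ : a₀ ∈ A) (h0 : a₀ ≠ 0) :
    Module.finrank ℚ ↥(𝒟.map (LinearMap.applyₗ a₀)) = Module.finrank ℚ A := by
  have hcount := finrank_map_domRestrict'_span_mul_eq T h𝒟 h1 hmul hAst hAirr ha₀ h0
  have hdvd := finrank_map_applyₗ_dvd_finrank T h𝒟 h1 hmul hAst hAirr ha₀ h0
  haveI := finite_map_domRestrict'_commutant T (A := A) h𝒟
  have hle : Module.finrank ℚ ↥((Submodule.span ℚ (Set.range T)).map (LinearMap.domRestrict' A)) ≤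
      Module.finrank ℚ ↥(𝒟.map (LinearMap.applyₗ a₀)) := by
    rw [← finrank_map_domRestrict'_commutant_eq T h𝒟 hAst hAirr ha₀ h0]
    exact Submodule.finrank_mono (Submodule.map_mono (span_range_le_commutant_of_comm T h𝒟 hAst hTc))
  have hA : 0 < Module.finrank ℚ A := by
    refine Nat.pos_of_ne_zero fun h' => h0 ?_
    have hbot : A = ⊥ := Submodule.finrank_eq_zero.1 h'
    exact (Submodule.mem_bot ℚ).1 (hbot ▸ ha₀)
  -- `δ ∣ n`, `n² = s·δ ≤ δ²` with `n > 0` force `δ = n`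
  obtain ⟨c, hc⟩ := hdvd
  set δ := Module.finrank ℚ ↥(𝒟.map (LinearMap.applyₗ a₀)) with hδ
  set n := Module.finrank ℚ A with hn
  set s := Module.finrank ℚ ↥((Submodule.span ℚ (Set.range T)).map (LinearMap.domRestrict' A)) with hs
  have hc1 : 1 ≤ c := by
    rcases Nat.eq_zero_or_pos c with h | h
    · rw [h, mul_zero] at hc; omega
    · exact h
  have hδpos : 0 < δ := by
    rcases Nat.eq_zero_or_pos δ with h | h
    · rw [h, zero_mul] at hc; omega
    · exact h
  -- from `s·δ = n·n = (δ c)(δ c)` and `s ≤ δ`: `δ c c ≤ δ`... precisely `δ·c·(δ·c) = s·δ ≤ δ·δ`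
  have h2 : δ * c * (δ * c) ≤ δ * δ := by
    rw [← hc, ← hcount]
    exact Nat.mul_le_mul_right δ hle
  have hc' : c * (δ * c) ≤ δ := by
    have h3 : δ * (c * (δ * c)) ≤ δ * δ := by rw [← mul_assoc]; exact h2
    exact Nat.le_of_mul_le_mul_left h3 hδpos
  have hcle : c ≤ 1 := by
    refine Nat.le_of_not_lt fun hlt => ?_
    have : δ * 2 ≤ c * (δ * c) := by nlinarith
    omega
  have hceq : c = 1 := le_antisymm hcle hc1
  rw [hc, hceq, mul_one]

/-- **THE COMMUTANT IS THE OPERATOR ALGEBRA: `𝒟|_A = span(T)|_A`** for commuting operators (`A ≠ 0` finite-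
dimensional stable irreducible, `T` closed under composition with identity): containment `⊇` (§1) and equal
dimension `dim A`. [cite: Serre1977, §3.1] [cite: CurtisReiner1962, §59] -/
theorem map_domRestrict'_commutant_eq_span_of_comm {𝒟 : Submodule ℚ (V →ₗ[ℚ] V)} {A : Submodule ℚ V}
    [FiniteDimensional ℚ A]
    (h𝒟 : ∀ L : V →ₗ[ℚ] V, L ∈ 𝒟 ↔ (∀ a ∈ A, L a ∈ A) ∧ ∀ (i : ι) (a : V), a ∈ A → L (T i a) = T i (L a))
    (h1 : ∃ i₀ : ι, T i₀ = LinearMap.id) (hmul : ∀ i i' : ι, ∃ i'' : ι, T i'' = T i ∘ₗ T i')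
    (hAst : ∀ (i : ι) (v : V), v ∈ A → T i v ∈ A)
    (hAirr : ∀ W : Submodule ℚ V, W ≤ A → W ≠ ⊥ → (∀ (i : ι) (v : V), v ∈ W → T i v ∈ W) → W = A)
    (hTc : ∀ (i j : ι) (a : V), a ∈ A → T i (T j a) = T j (T i a)) (hA : A ≠ ⊥) :
    𝒟.map (LinearMap.domRestrict' A) = (Submodule.span ℚ (Set.range T)).map (LinearMap.domRestrict' A) := by
  obtain ⟨a₀, ha₀, h0⟩ := Submodule.exists_mem_ne_zero_of_ne_bot hA
  haveI := finite_map_domRestrict'_commutant T (A := A) h𝒟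
  refine (Submodule.eq_of_le_of_finrank_eq
    (Submodule.map_mono (span_range_le_commutant_of_comm T h𝒟 hAst hTc)) ?_).symm
  -- `dim span(T)|_A · δ = n²` with `δ = n`, and `dim 𝒟|_A = δ`
  have hδ := finrank_map_applyₗ_eq_finrank_of_comm T h𝒟 h1 hmul hAst hAirr hTc ha₀ h0
  have hcount := finrank_map_domRestrict'_span_mul_eq T h𝒟 h1 hmul hAst hAirr ha₀ h0
  rw [finrank_map_domRestrict'_commutant_eq T h𝒟 hAst hAirr ha₀ h0, hδ] at *
  have hA' : 0 < Module.finrank ℚ A :=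
    Nat.pos_of_ne_zero fun h' => hA (Submodule.finrank_eq_zero.1 h')
  exact Nat.eq_of_mul_eq_mul_right hA' hcount

/-- **`dim span(T)|_A = dim A`** for commuting operators (`A ≠ 0`). [cite: Serre1977, §3.1] -/
theorem finrank_map_domRestrict'_span_eq_finrank_of_comm {𝒟 : Submodule ℚ (V →ₗ[ℚ] V)} {A : Submodule ℚ V}
    [FiniteDimensional ℚ A]
    (h𝒟 : ∀ L : V →ₗ[ℚ] V, L ∈ 𝒟 ↔ (∀ a ∈ A, L a ∈ A) ∧ ∀ (i : ι) (a : V), a ∈ A → L (T i a) = T i (L a))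
    (h1 : ∃ i₀ : ι, T i₀ = LinearMap.id) (hmul : ∀ i i' : ι, ∃ i'' : ι, T i'' = T i ∘ₗ T i')
    (hAst : ∀ (i : ι) (v : V), v ∈ A → T i v ∈ A)
    (hAirr : ∀ W : Submodule ℚ V, W ≤ A → W ≠ ⊥ → (∀ (i : ι) (v : V), v ∈ W → T i v ∈ W) → W = A)
    (hTc : ∀ (i j : ι) (a : V), a ∈ A → T i (T j a) = T j (T i a)) {a₀ : V} (ha₀ : a₀ ∈ A) (h0 : a₀ ≠ 0) :
    Module.finrank ℚ ↥((Submodule.span ℚ (Set.range T)).map (LinearMap.domRestrict' A)) = Module.finrank ℚ A := by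
  have hA : A ≠ ⊥ := fun hbot => h0 ((Submodule.mem_bot ℚ).1 (hbot ▸ ha₀))
  rw [← map_domRestrict'_commutant_eq_span_of_comm T h𝒟 h1 hmul hAst hAirr hTc hA,
    finrank_map_domRestrict'_commutant_eq T h𝒟 hAst hAirr ha₀ h0]
  exact finrank_map_applyₗ_eq_finrank_of_comm T h𝒟 h1 hmul hAst hAirr hTc ha₀ h0

/-- **THE COMMUTANT OF A COMMUTING FAMILY IS COMMUTATIVE ON `A`** (`𝒟|_A = span(T)|_A`, and members of `span(T)`
commute with `𝒟` on `A`, file C1; also file Z1's `map_domRestrict'_commutant_le_span_iff_comm`).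
[cite: Serre1977, §3.1] [cite: CurtisReiner1962, §59] -/
theorem commutant_apply_comm_of_comm {𝒟 : Submodule ℚ (V →ₗ[ℚ] V)} {A : Submodule ℚ V} [FiniteDimensional ℚ A]
    (h𝒟 : ∀ L : V →ₗ[ℚ] V, L ∈ 𝒟 ↔ (∀ a ∈ A, L a ∈ A) ∧ ∀ (i : ι) (a : V), a ∈ A → L (T i a) = T i (L a))
    (h1 : ∃ i₀ : ι, T i₀ = LinearMap.id) (hmul : ∀ i i' : ι, ∃ i'' : ι, T i'' = T i ∘ₗ T i')
    (hAst : ∀ (i : ι) (v : V), v ∈ A → T i v ∈ A)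
    (hAirr : ∀ W : Submodule ℚ V, W ≤ A → W ≠ ⊥ → (∀ (i : ι) (v : V), v ∈ W → T i v ∈ W) → W = A)
    (hTc : ∀ (i j : ι) (a : V), a ∈ A → T i (T j a) = T j (T i a))
    {L L' : V →ₗ[ℚ] V} (hL : L ∈ 𝒟) (hL' : L' ∈ 𝒟) {a : V} (ha : a ∈ A) : L (L' a) = L' (L a) := by
  by_cases hA : A = ⊥
  · -- on `A = 0` the only vector is `a = 0`
    rw [hA, Submodule.mem_bot] at ha
    subst ha
    simp only [map_zero]
  · have hle : 𝒟.map (LinearMap.domRestrict' A) ≤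
        (Submodule.span ℚ (Set.range T)).map (LinearMap.domRestrict' A) :=
      (map_domRestrict'_commutant_eq_span_of_comm T h𝒟 h1 hmul hAst hAirr hTc hA).le
    exact (map_domRestrict'_commutant_le_span_iff_comm T h𝒟 h1 hmul hAst hAirr).1 hle L hL L' hL' a ha

/-- **THE COMMUTANT IS TRANSITIVE: `D·a₀ = A`** for commuting operators and `0 ≠ a₀ ∈ A` (the D-line has dimension
`δ = dim A`). [cite: Serre1977, §3.1] [cite: Lang2002, XVII §1 Prop. 1.1] -/
theorem map_applyₗ_eq_of_comm {𝒟 : Submodule ℚ (V →ₗ[ℚ] V)} {A : Submodule ℚ V} [FiniteDimensional ℚ A]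
    (h𝒟 : ∀ L : V →ₗ[ℚ] V, L ∈ 𝒟 ↔ (∀ a ∈ A, L a ∈ A) ∧ ∀ (i : ι) (a : V), a ∈ A → L (T i a) = T i (L a))
    (h1 : ∃ i₀ : ι, T i₀ = LinearMap.id) (hmul : ∀ i i' : ι, ∃ i'' : ι, T i'' = T i ∘ₗ T i')
    (hAst : ∀ (i : ι) (v : V), v ∈ A → T i v ∈ A)
    (hAirr : ∀ W : Submodule ℚ V, W ≤ A → W ≠ ⊥ → (∀ (i : ι) (v : V), v ∈ W → T i v ∈ W) → W = A)
    (hTc : ∀ (i j : ι) (a : V), a ∈ A → T i (T j a) = T j (T i a)) {a₀ : V} (ha₀ : a₀ ∈ A) (h0 : a₀ ≠ 0) :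
    𝒟.map (LinearMap.applyₗ a₀) = A :=
  Submodule.eq_of_le_of_finrank_eq (map_applyₗ_le T h𝒟 ha₀)
    (finrank_map_applyₗ_eq_finrank_of_comm T h𝒟 h1 hmul hAst hAirr hTc ha₀ h0)

end Summit.HodgeConjecture.CorCM.IrrOdd

end
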